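import Summits.AtomisticToContinuum.HydrodynamicLimit.Theorems.BoxDissipativeWeakStrongLocalGibbsFineScaleUniformTwoPt

/-!
# One-body statics of the canonical hard-sphere gas, uniformly over bounded observables, file 1:
the coefficients and the one-point expectation

Support lemmas for stub `stub_oneBodyStatics` (ML) of line `contact-asymmetry-information` of the
crux `LocalSecondLaw` (item stmt-AtomisticToContinuum-13081). For the configurational canonical
hard-sphere gas `Ξ⁻¹ · (β dy)^{⊗(N+1)}|_{hard core}` at small reduced density (`SmallDensity P σ`,
the tree's cluster-expansion regime of `HardSphereEulerRatio` / `HardSphereEulerLLN`) we make the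
tree's one-point cluster limit `SmallDensity.tendsto_onePt` (one FIXED bounded test function,
Tannery's theorem) **uniform over the unit ball `{g measurable, |g| ≤ 1}`**:

* `coefN_uniform`: `∀ η > 0, ∀ᶠ N, ∀ g, |C(N-s, j) W^g_N(j+1) - γ_{j+1} ∫ g β^{j+1}| ≤ η` — by the
  exact scaling identity `C(N-s,j) W^g(j+1) = C(N-s,j) ε_N^{3j} ∫ g β J_{ε_N}` (`Wd_self_eq_pow_mul`)
  and `γ_{j+1} = (σ³)ʲ/j! · b_{j+1}`, the difference is
  `(a_N - a) ∫ g β J_ε + a ∫ g β (J_ε - b βʲ)`, both uniformly small for `|g| ≤ 1`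
  (`abs_Jint_le`, `MesoLLN.abs_Jint_sub_le` = uniform continuity of `β`,
  `tendsto_choose_sub_mul_hsDiameter_pow`);
* `coefN_mul_rN_uniform`: the same with the ratio products `r_N(N+1-s, j+1) → R^{j+1}`;
* `onePt_uniform`: `∀ s, ∀ δ > 0, ∀ᶠ N, ∀ g, |E_{N+1-s}[g(x₀)] - I(g)| ≤ δ` — head/tail split of
  the size-form expansion (`LGFS.onePt_eq_sum`) with the geometric majorant `2e θʲ`
  (`LGFS.abs_coefN_mul_rN_le`, `abs_Ilim_term_le`), uniform in `g`;
* `abs_Ilim_le`: `|I(g)| ≤ 2e/(1-θ)`; `Ilim_eq_integral_of_measurable`: `I(g) = ∫ g ρ₀` for bounded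
  measurable `g` (the tree's `Ilim_eq_integral` assumed continuity only for boundedness).

References: H. Spohn, *Large Scale Dynamics of Interacting Particles* (1991), Part I §2.3
(2.45)–(2.46); E. Pulvirenti, D. Tsagkarogiannis, Comm. Math. Phys. 316 (2012) §3–5.
-/

noncomputable section

namespace Summit.AtomisticToContinuum.HydrodynamicLimit.Theorems
namespace LocalSecondLawOneBodyStatics
open MeasureTheory Finset Filter Topology
open Literature.Probability.LatticeModels Literature.MathematicalPhysics.StatisticalMechanics
  Literature.MathematicalPhysics.KineticTheory
open Literature.Analysis.FluidPDE.Torus (euclidDist)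
open scoped ENNReal

variable {P : DensityProfile} {σ : ℝ}

/-! ### Bounded observables on the torus -/

/-- `|∫ g F| ≤ B` on `𝕋³` whenever `|g| ≤ 1` and `|F| ≤ B` (Haar probability measure). -/
theorem abs_integral_mul_le {g F : T3 → ℝ} (hg1 : ∀ y, |g y| ≤ 1) {B : ℝ} (hFB : ∀ y, |F y| ≤ B) :
    |∫ y, g y * F y| ≤ B := by
  calc |∫ y, g y * F y| ≤ ∫ y, |g y * F y| := abs_integral_le_integral_abs
    _ ≤ ∫ _ : T3, B := by
        refine integral_mono_of_nonneg (ae_of_all _ fun _ => abs_nonneg _) (integrable_const B)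
          (ae_of_all _ fun y => ?_)
        dsimp only
        rw [abs_mul]
        calc |g y| * |F y| ≤ 1 * B := mul_le_mul (hg1 y) (hFB y) (abs_nonneg _) zero_le_one
          _ = B := one_mul B
    _ = B := by simp

/-- `∫ |g| dμ ≤ 1` for `|g| ≤ 1` (`μ = β dy` is a probability measure). -/
theorem integral_abs_μ_le_one {g : T3 → ℝ} (hg1 : ∀ y, |g y| ≤ 1) : ∫ y, |g y| ∂P.μ ≤ 1 := by
  calc ∫ y, |g y| ∂P.μ ≤ ∫ _, (1 : ℝ) ∂P.μ :=
        integral_mono_of_nonneg (ae_of_all _ fun _ => abs_nonneg _) (integrable_const _)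
          (ae_of_all _ hg1)
    _ = 1 := by simp

/-! ### The coefficients converge uniformly over the unit ball of observables -/

/-- **Uniform convergence of the coefficients.** For every shift `s` and every `j`:
`∀ η > 0, ∀ᶠ N, ∀ g` measurable with `|g| ≤ 1`,
`|C(N-s, j) W^g_N(j+1) - γ_{j+1} ∫ g β^{j+1}| ≤ η`. -/
theorem coefN_uniform (hs : SmallDensity P σ) (s j : ℕ) {η : ℝ} (hη : 0 < η) :
    ∀ᶠ N in atTop, ∀ g : T3 → ℝ, Measurable g → (∀ y, |g y| ≤ 1) →
      |coefN P σ N g (N - s) j - coefLim P σ g j| ≤ η := by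
  have hσ := hs.σ_pos
  have hM := P.M_pos
  set Dm := ∫ z, domF P j z with hDm
  have hDm0 : 0 ≤ Dm := LGFS.integral_domF_nonneg P j
  set a := (σ ^ 3) ^ j / (j.factorial : ℝ) with ha
  have ha0 : 0 ≤ a := by positivity
  -- the small parameter of the modulus of `β`
  obtain ⟨η₁, hη₁, hη₁le⟩ := LGFS.exists_pos_mul_le (ε := η / 2) (K := a * (P.M * (j * Dm)))
    (by positivity) (by positivity)
  obtain ⟨δ₁, hδ₁, hδ₁f⟩ := MesoLLN.exists_forall_euclidDist_lt_norm_sub_lt P.continuous hη₁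
  -- the eventual conditions on `N`
  have hE1 : ∀ᶠ N : ℕ in atTop, j ≤ N := eventually_ge_atTop j
  have hE2 : ∀ᶠ N : ℕ in atTop, (j : ℝ) * hsDiameter σ N < min (1 / 4) δ₁ := by
    have := (tendsto_hsDiameter σ).const_mul (j : ℝ)
    rw [mul_zero] at this
    exact this.eventually (gt_mem_nhds (lt_min (by norm_num) hδ₁))
  have hE3 : ∀ᶠ N : ℕ in atTop,
      |((N - s).choose j : ℝ) * hsDiameter σ N ^ (3 * j) - a| * (P.M * Dm) ≤ η / 2 := by
    have h1 := tendsto_choose_sub_mul_hsDiameter_pow σ s j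
    have h2 : Tendsto (fun N : ℕ => |((N - s).choose j : ℝ) * hsDiameter σ N ^ (3 * j) - a| * (P.M * Dm))
        atTop (𝓝 0) := by
      have := ((h1.sub_const a).abs.mul_const (P.M * Dm))
      rw [sub_self, abs_zero, zero_mul] at this
      exact this
    exact (h2.eventually (ge_mem_nhds (by positivity : (0 : ℝ) < η / 2))).mono fun N hN => hN
  filter_upwards [hE1, hE2, hE3] with N hN1 hN2 hN3 g hgm hg1
  -- notation
  set ε := hsDiameter σ N with hε
  have hε0 : 0 < ε := hsDiameter_pos hσ N
  have hjε : (j : ℝ) * ε < 1 / 4 := hN2.trans_le (min_le_left _ _)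
  have hjδ : (j : ℝ) * ε < δ₁ := hN2.trans_le (min_le_right _ _)
  -- the exact scaling identity
  haveI : NeZero (j + 1) := ⟨Nat.succ_ne_zero _⟩
  have hcoef : coefN P σ N g (N - s) j =
      (((N - s).choose j : ℝ) * ε ^ (3 * j)) * ∫ y, g y * P.β y * Jint P ε j y := by
    rw [coefN, ← hε, Wd_eq_Wd_self P ε (show j + 1 ≤ N + 1 by omega) hgm,
      Wd_self_eq_pow_mul P hε0 hjε hgm hg1, mul_assoc]
  set aN := ((N - s).choose j : ℝ) * ε ^ (3 * j) with haN
  set IN := ∫ y, g y * P.β y * Jint P ε j y with hIN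
  -- bounds on the pieces
  have hJb : ∀ y, |P.β y * Jint P ε j y| ≤ P.M * Dm := fun y => by
    rw [abs_mul, abs_of_pos (P.pos y)]
    exact mul_le_mul (P.le_M y) (abs_Jint_le P ε j y) (abs_nonneg _) hM.le
  have hIN_le : |IN| ≤ P.M * Dm := by
    have h := abs_integral_mul_le hg1 hJb
    rw [hIN]
    simp_rw [mul_assoc]
    exact h
  -- modulus of `β` on the scale `j ε`
  have hmod1 : ∀ x' y : T3, euclidDist y x' ≤ j * ε → |P.β y - P.β x'| ≤ η₁ := by
    intro x' y hxy
    have h := hδ₁f y x' (hxy.trans_lt hjδ)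
    rw [Real.norm_eq_abs] at h
    exact h.le
  have hJint : ∀ y, |Jint P ε j y - bE j * P.β y ^ j| ≤ j * η₁ * Dm := fun y =>
    MesoLLN.abs_Jint_sub_le P j hε0.le hη₁.le hmod1 y
  -- the error `∫ g (β J - b β^{j+1})`
  have hF1 : |(∫ y, g y * (P.β y * Jint P ε j y)) - ∫ y, g y * (bE j * P.β y ^ (j + 1))| ≤
      P.M * (j * η₁ * Dm) := by
    have hm1 : Measurable fun y => P.β y * Jint P ε j y :=
      P.continuous.measurable.mul (measurable_Jint P ε j)
    have hm2 : Measurable fun y => bE j * P.β y ^ (j + 1) :=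
      measurable_const.mul (P.continuous.measurable.pow_const _)
    have hb2 : ∀ y, |bE j * P.β y ^ (j + 1)| ≤ |bE j| * P.M ^ (j + 1) := fun y => by
      rw [abs_mul, abs_of_nonneg (pow_nonneg (P.pos y).le _)]
      exact mul_le_mul_of_nonneg_left (pow_le_pow_left₀ (P.pos y).le (P.le_M y) _) (abs_nonneg _)
    have hi1 : Integrable fun y => g y * (P.β y * Jint P ε j y) :=
      (integrable_const (1 * (P.M * Dm))).mono' (hgm.mul hm1).aestronglyMeasurable
        (ae_of_all _ fun y => by
          rw [Real.norm_eq_abs, abs_mul]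
          exact mul_le_mul (hg1 y) (hJb y) (abs_nonneg _) zero_le_one)
    have hi2 : Integrable fun y => g y * (bE j * P.β y ^ (j + 1)) :=
      (integrable_const (1 * (|bE j| * P.M ^ (j + 1)))).mono' (hgm.mul hm2).aestronglyMeasurable
        (ae_of_all _ fun y => by
          rw [Real.norm_eq_abs, abs_mul]
          exact mul_le_mul (hg1 y) (hb2 y) (abs_nonneg _) zero_le_one)
    rw [← integral_sub hi1 hi2]
    have hdiff : ∀ y, |P.β y * Jint P ε j y - bE j * P.β y ^ (j + 1)| ≤ P.M * (j * η₁ * Dm) := by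
      intro y
      have : P.β y * Jint P ε j y - bE j * P.β y ^ (j + 1) =
          P.β y * (Jint P ε j y - bE j * P.β y ^ j) := by ring
      rw [this, abs_mul, abs_of_pos (P.pos y)]
      exact mul_le_mul (P.le_M y) (hJint y) (abs_nonneg _) hM.le
    have h := abs_integral_mul_le hg1 hdiff
    refine le_trans (le_of_eq ?_) h
    congr 1
    refine integral_congr_ae (ae_of_all _ fun y => ?_)
    ring
  -- assemble
  have hcc : coefLim P σ g j = a * bE j * ∫ y, g y * P.β y ^ (j + 1) := by
    rw [coefLim, clusterCoeff, ha]
  have hsplit : coefN P σ N g (N - s) j - coefLim P σ g j =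
      (aN - a) * IN +
        a * ((∫ y, g y * (P.β y * Jint P ε j y)) - ∫ y, g y * (bE j * P.β y ^ (j + 1))) := by
    have hI1 : IN = ∫ y, g y * (P.β y * Jint P ε j y) := by
      rw [hIN]; refine integral_congr_ae (ae_of_all _ fun y => ?_); ring
    have hI2 : ∫ y, g y * (bE j * P.β y ^ (j + 1)) = bE j * ∫ y, g y * P.β y ^ (j + 1) := by
      rw [← integral_const_mul]; refine integral_congr_ae (ae_of_all _ fun y => ?_); ring
    rw [hcoef, hcc, hI2, hI1]
    ring
  rw [hsplit]
  have hT1 : |(aN - a) * IN| ≤ η / 2 := by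
    rw [abs_mul]
    exact (mul_le_mul_of_nonneg_left hIN_le (abs_nonneg _)).trans hN3
  have hT2 : |a * ((∫ y, g y * (P.β y * Jint P ε j y)) - ∫ y, g y * (bE j * P.β y ^ (j + 1)))| ≤
      η / 2 := by
    rw [abs_mul, abs_of_nonneg ha0]
    calc a * |(∫ y, g y * (P.β y * Jint P ε j y)) - ∫ y, g y * (bE j * P.β y ^ (j + 1))|
        ≤ a * (P.M * (j * η₁ * Dm)) := mul_le_mul_of_nonneg_left hF1 ha0
      _ = a * (P.M * (j * Dm)) * η₁ := by ring
      _ ≤ η / 2 := hη₁le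
  calc |(aN - a) * IN + a * ((∫ y, g y * (P.β y * Jint P ε j y)) - ∫ y, g y * (bE j * P.β y ^ (j + 1)))|
      ≤ |(aN - a) * IN| + |a * ((∫ y, g y * (P.β y * Jint P ε j y)) - ∫ y, g y * (bE j * P.β y ^ (j + 1)))| :=
        abs_add_le _ _
    _ ≤ η / 2 + η / 2 := add_le_add hT1 hT2
    _ = η := by ring

/-- **Termwise uniform convergence**: for every shift `s` and every `j`,
`∀ η > 0, ∀ᶠ N, ∀ g` measurable with `|g| ≤ 1`,
`|C(N-s,j) W^g_N(j+1) r_N(N+1-s,j+1) - γ_{j+1} (∫ g β^{j+1}) R^{j+1}| ≤ η`. -/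
theorem coefN_mul_rN_uniform (hs : SmallDensity P σ) (s j : ℕ) {η : ℝ} (hη : 0 < η) :
    ∀ᶠ N in atTop, ∀ g : T3 → ℝ, Measurable g → (∀ y, |g y| ≤ 1) →
      |coefN P σ N g (N - s) j * rN P σ N (N + 1 - s) (j + 1) -
        coefLim P σ g j * ratioLimit P σ ^ (j + 1)| ≤ η := by
  have hl0 := hs.ovDensity_nonneg
  set B := (1 : ℝ) * (Real.exp 1 * (Real.exp 1 * ovDensity P σ) ^ j) with hB
  have hB0 : 0 ≤ B := by positivity
  set R := ratioLimit P σ with hR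
  have hR0 : 0 ≤ R ^ (j + 1) := pow_nonneg hs.ratioLimit_pos.le _
  have hR2 : R ^ (j + 1) ≤ 2 ^ (j + 1) := pow_le_pow_left₀ hs.ratioLimit_pos.le hs.ratioLimit_mem.2 _
  -- `r_N → R^{j+1}`
  obtain ⟨η₁, hη₁, hη₁le⟩ := LGFS.exists_pos_mul_le (ε := η / 2) (K := B) (by positivity) hB0
  have hE1 : ∀ᶠ N : ℕ in atTop, |rN P σ N (N + 1 - s) (j + 1) - R ^ (j + 1)| ≤ η₁ := by
    have h := hs.tendsto_rN s (j + 1)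
    rw [← hR] at h
    have h2 : Tendsto (fun N => |rN P σ N (N + 1 - s) (j + 1) - R ^ (j + 1)|) atTop (𝓝 0) := by
      have := (h.sub_const (R ^ (j + 1))).abs
      rw [sub_self, abs_zero] at this
      exact this
    exact (h2.eventually (ge_mem_nhds hη₁)).mono fun N hN => hN
  -- the coefficients, uniformly
  obtain ⟨η₂, hη₂, hη₂le⟩ := LGFS.exists_pos_mul_le (ε := η / 2) (K := (2 : ℝ) ^ (j + 1))
    (by positivity) (by positivity)
  have hE2 := coefN_uniform hs s j hη₂
  have hE3 : ∀ᶠ N : ℕ in atTop, j ≤ N := eventually_ge_atTop j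
  filter_upwards [hE1, hE2, hE3] with N hN1 hN2 hN3 g hgm hg1
  have hco : |coefN P σ N g (N - s) j| ≤ B :=
    abs_coefN_le (P := P) hs.σ_pos.le hs.σ_lt_half hgm hg1 (N := N) (m := N - s) (j := j) hN3
      (by omega)
  have hsplit : coefN P σ N g (N - s) j * rN P σ N (N + 1 - s) (j + 1) - coefLim P σ g j * R ^ (j + 1) =
      coefN P σ N g (N - s) j * (rN P σ N (N + 1 - s) (j + 1) - R ^ (j + 1)) +
        (coefN P σ N g (N - s) j - coefLim P σ g j) * R ^ (j + 1) := by ring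
  rw [hsplit]
  calc |coefN P σ N g (N - s) j * (rN P σ N (N + 1 - s) (j + 1) - R ^ (j + 1)) +
        (coefN P σ N g (N - s) j - coefLim P σ g j) * R ^ (j + 1)|
      ≤ |coefN P σ N g (N - s) j| * |rN P σ N (N + 1 - s) (j + 1) - R ^ (j + 1)| +
        |coefN P σ N g (N - s) j - coefLim P σ g j| * R ^ (j + 1) := by
        refine (abs_add_le _ _).trans (le_of_eq ?_)
        rw [abs_mul, abs_mul, abs_of_nonneg hR0]
    _ ≤ B * η₁ + η₂ * 2 ^ (j + 1) :=
        add_le_add (mul_le_mul hco hN1 (abs_nonneg _) hB0)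
          (mul_le_mul (hN2 g hgm hg1) hR2 hR0 hη₂.le)
    _ ≤ η / 2 + η / 2 := add_le_add hη₁le (by rw [mul_comm]; exact hη₂le)
    _ = η := by ring

/-! ### The one-point expectation, uniformly over the unit ball of observables -/

/-- **The uniform one-point limit.** For every shift `s`:
`∀ δ > 0, ∀ᶠ N, ∀ g` measurable with `|g| ≤ 1`, `|E_{N+1-s}[g(x₀)] - I(g)| ≤ δ`, where
`I(g) = Ilim P σ g = ∑_j γ_{j+1} (∫ g β^{j+1}) R^{j+1}` (small density). Head/tail split of the
size-form expansion with the geometric majorant `2e θʲ`, uniform in `g`, and the termwise uniform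
limits `coefN_mul_rN_uniform`. -/
theorem onePt_uniform :
    ∀ {P : DensityProfile} {σ : ℝ}, SmallDensity P σ → ∀ (s : ℕ) {δ : ℝ}, 0 < δ →
      ∀ᶠ N in atTop, ∀ g : T3 → ℝ, Measurable g → (∀ y, |g y| ≤ 1) →
        |onePt P σ g N s - Ilim P σ g| ≤ δ := by
  intro P σ hs s δ hδ
  have hθ0 := hs.geomRatio_nonneg
  have hθ1 := hs.geomRatio_lt_one
  have hA0 : (0 : ℝ) ≤ 2 * Real.exp 1 := by positivity
  -- the tail index `J`
  have htail : Tendsto (fun J : ℕ => 2 * Real.exp 1 * geomRatio P σ ^ J / (1 - geomRatio P σ))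
      atTop (𝓝 0) := by
    have := ((tendsto_pow_atTop_nhds_zero_of_lt_one hθ0 hθ1).const_mul (2 * Real.exp 1)).div_const
      (1 - geomRatio P σ)
    rw [mul_zero, zero_div] at this
    exact this
  obtain ⟨J, hJ⟩ := (htail.eventually (ge_mem_nhds (by positivity : (0 : ℝ) < δ / 4))).exists
  have hgeo : HasSum (fun i : ℕ => 2 * Real.exp 1 * geomRatio P σ ^ J * geomRatio P σ ^ i)
      (2 * Real.exp 1 * geomRatio P σ ^ J / (1 - geomRatio P σ)) := by
    have h := (hasSum_geometric_of_lt_one hθ0 hθ1).mul_left (2 * Real.exp 1 * geomRatio P σ ^ J)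
    rwa [← div_eq_mul_inv] at h
  -- the head: finitely many termwise uniform limits
  have hhead : ∀ᶠ N in atTop, ∀ j ∈ range J, ∀ g : T3 → ℝ, Measurable g → (∀ y, |g y| ≤ 1) →
      |coefN P σ N g (N - s) j * rN P σ N (N + 1 - s) (j + 1) -
        coefLim P σ g j * ratioLimit P σ ^ (j + 1)| ≤ δ / (2 * ((J : ℝ) + 1)) := by
    refine (Finset.eventually_all (range J)).2 fun j _ => ?_
    exact coefN_mul_rN_uniform hs s j (by positivity)
  have hE : ∀ᶠ N : ℕ in atTop, s + J ≤ N := eventually_ge_atTop _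
  filter_upwards [hhead, hE] with N hN hNJ g hgm hg1
  have hI : ∫ y, |g y| ∂P.μ ≤ 1 := integral_abs_μ_le_one hg1
  -- names for the terms
  set F : ℕ → ℝ := fun j => coefN P σ N g (N - s) j * rN P σ N (N + 1 - s) (j + 1) with hF
  set T : ℕ → ℝ := fun j => coefLim P σ g j * ratioLimit P σ ^ (j + 1) with hT
  have hFle : ∀ j, j < N + 1 - s → |F j| ≤ 2 * Real.exp 1 * geomRatio P σ ^ j := fun j hj =>
    (LGFS.abs_coefN_mul_rN_le hs hgm hg1 hI hj).trans_eq (by ring)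
  have hTle : ∀ j, |T j| ≤ 2 * Real.exp 1 * geomRatio P σ ^ j := fun j =>
    (hs.abs_Ilim_term_le hgm hg1 j).trans_eq (by ring)
  -- expansion and splitting
  have hsumT := hs.summable_Ilim hgm hg1
  have hexp : onePt P σ g N s = ∑ j ∈ range J, F j + ∑ j ∈ Ico J (N + 1 - s), F j := by
    rw [LGFS.onePt_eq_sum hgm hg1 (show s ≤ N by omega),
      Finset.sum_range_add_sum_Ico _ (show J ≤ N + 1 - s by omega)]
  have hlim : Ilim P σ g = ∑ j ∈ range J, T j + ∑' j, T (j + J) := by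
    rw [Ilim, ← hsumT.sum_add_tsum_nat_add J]
  rw [hexp, hlim]
  -- the three pieces
  have h1 : |∑ j ∈ range J, F j - ∑ j ∈ range J, T j| ≤ δ / 2 := by
    rw [← sum_sub_distrib]
    calc |∑ j ∈ range J, (F j - T j)| ≤ ∑ j ∈ range J, |F j - T j| := abs_sum_le_sum_abs _ _
      _ ≤ ∑ _j ∈ range J, δ / (2 * ((J : ℝ) + 1)) := sum_le_sum fun j hj => hN j hj g hgm hg1
      _ = J * (δ / (2 * ((J : ℝ) + 1))) := by rw [sum_const, card_range, nsmul_eq_mul]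
      _ ≤ δ / 2 := by
          rw [mul_div_assoc', div_le_div_iff₀ (by positivity) (by positivity)]
          nlinarith
  have h2 : |∑ j ∈ Ico J (N + 1 - s), F j| ≤ δ / 4 := by
    calc |∑ j ∈ Ico J (N + 1 - s), F j| ≤ ∑ j ∈ Ico J (N + 1 - s), |F j| := abs_sum_le_sum_abs _ _
      _ ≤ ∑ j ∈ Ico J (N + 1 - s), 2 * Real.exp 1 * geomRatio P σ ^ j :=
          sum_le_sum fun j hj => hFle j (mem_Ico.1 hj).2
      _ = ∑ i ∈ range (N + 1 - s - J), 2 * Real.exp 1 * geomRatio P σ ^ J * geomRatio P σ ^ i := by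
          rw [sum_Ico_eq_sum_range]
          refine sum_congr rfl fun i _ => ?_
          rw [pow_add]; ring
      _ ≤ 2 * Real.exp 1 * geomRatio P σ ^ J / (1 - geomRatio P σ) :=
          sum_le_hasSum _ (fun i _ => by positivity) hgeo
      _ ≤ δ / 4 := hJ
  have h3 : |∑' j, T (j + J)| ≤ δ / 4 := by
    refine le_trans ?_ hJ
    refine (Real.norm_eq_abs _).symm.trans_le (tsum_of_norm_bounded hgeo fun i => ?_)
    rw [Real.norm_eq_abs]
    calc |T (i + J)| ≤ 2 * Real.exp 1 * geomRatio P σ ^ (i + J) := hTle (i + J)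
      _ = 2 * Real.exp 1 * geomRatio P σ ^ J * geomRatio P σ ^ i := by rw [pow_add]; ring
  have hsplit : ∑ j ∈ range J, F j + ∑ j ∈ Ico J (N + 1 - s), F j - (∑ j ∈ range J, T j + ∑' j, T (j + J)) =
      (∑ j ∈ range J, F j - ∑ j ∈ range J, T j) + ∑ j ∈ Ico J (N + 1 - s), F j - ∑' j, T (j + J) := by
    ring
  rw [hsplit]
  calc |(∑ j ∈ range J, F j - ∑ j ∈ range J, T j) + ∑ j ∈ Ico J (N + 1 - s), F j - ∑' j, T (j + J)|
      ≤ |∑ j ∈ range J, F j - ∑ j ∈ range J, T j| + |∑ j ∈ Ico J (N + 1 - s), F j| +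
          |∑' j, T (j + J)| := by
        have hx1 := abs_sub (∑ j ∈ range J, F j - ∑ j ∈ range J, T j + ∑ j ∈ Ico J (N + 1 - s), F j)
          (∑' j, T (j + J))
        have hx2 := abs_add_le (∑ j ∈ range J, F j - ∑ j ∈ range J, T j) (∑ j ∈ Ico J (N + 1 - s), F j)
        linarith
    _ ≤ δ / 2 + δ / 4 + δ / 4 := add_le_add_three h1 h2 h3
    _ = δ := by ring

/-! ### The limit functional `I(g)`: bound and identification with `∫ g ρ₀` -/

/-- `|I(g)| ≤ 2e/(1-θ)` for `|g| ≤ 1` measurable (geometric majorant of the defining series). -/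
theorem abs_Ilim_le (hs : SmallDensity P σ) {g : T3 → ℝ} (hgm : Measurable g)
    (hg1 : ∀ y, |g y| ≤ 1) : |Ilim P σ g| ≤ 2 * Real.exp 1 / (1 - geomRatio P σ) := by
  have hθ0 := hs.geomRatio_nonneg
  have hθ1 := hs.geomRatio_lt_one
  have hgeo : HasSum (fun j : ℕ => 2 * Real.exp 1 * geomRatio P σ ^ j)
      (2 * Real.exp 1 / (1 - geomRatio P σ)) := by
    have h := (hasSum_geometric_of_lt_one hθ0 hθ1).mul_left (2 * Real.exp 1)
    rwa [← div_eq_mul_inv] at h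
  rw [Ilim]
  refine (Real.norm_eq_abs _).symm.trans_le (tsum_of_norm_bounded hgeo fun j => ?_)
  rw [Real.norm_eq_abs]
  exact (hs.abs_Ilim_term_le hgm hg1 j).trans_eq (by ring)

/-- **Identification of the limit for bounded measurable observables**: `I(g) = ∫ g ρ₀`,
`ρ₀ = rhoLim P σ` (interchange of the series and the integral by the uniform majorant; the tree's
`SmallDensity.Ilim_eq_integral` for continuous `g`, verbatim with boundedness in place of
continuity). -/
theorem Ilim_eq_integral_of_measurable (hs : SmallDensity P σ) {g : T3 → ℝ} (hgm : Measurable g)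
    {C : ℝ} (hgC : ∀ y, |g y| ≤ C) : Ilim P σ g = ∫ y, g y * rhoLim P σ y := by
  have hC0 : 0 ≤ C := (abs_nonneg _).trans (hgC 0)
  set F : ℕ → T3 → ℝ := fun j y =>
    g y * (clusterCoeff σ j * ratioLimit P σ ^ (j + 1) * P.β y ^ (j + 1)) with hF
  have hFm : ∀ j, Measurable (F j) := fun j =>
    hgm.mul (measurable_const.mul (P.continuous.measurable.pow_const _))
  have hFbound : ∀ j y, ‖F j y‖ ≤ C * (2 * Real.exp 1 * P.M * geomRatio P σ ^ j) := by
    intro j y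
    rw [Real.norm_eq_abs, hF]
    dsimp only
    rw [abs_mul]
    exact mul_le_mul (hgC y) (hs.abs_rhoLim_term_le j y) (abs_nonneg _) hC0
  have hFint : ∀ j, Integrable (F j) := fun j =>
    (integrable_const _).mono' (hFm j).aestronglyMeasurable (ae_of_all _ (hFbound j))
  have hsum : Summable fun j => ∫ y, ‖F j y‖ := by
    refine Summable.of_nonneg_of_le (fun j => integral_nonneg fun y => norm_nonneg _)
      (fun j => ?_) (hs.summable_rhoLim_majorant.mul_left C)
    calc ∫ y, ‖F j y‖ ≤ ∫ _ : T3, C * (2 * Real.exp 1 * P.M * geomRatio P σ ^ j) :=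
          integral_mono (hFint j).norm (integrable_const _) (hFbound j)
      _ = C * (2 * Real.exp 1 * P.M * geomRatio P σ ^ j) := by simp
  have hterm : ∀ j, coefLim P σ g j * ratioLimit P σ ^ (j + 1) = ∫ y, F j y := by
    intro j
    rw [coefLim, hF]
    dsimp only
    rw [mul_comm, ← mul_assoc, ← integral_const_mul]
    refine integral_congr_ae (ae_of_all _ fun y => ?_)
    ring
  rw [Ilim]
  simp_rw [hterm]
  rw [integral_tsum_of_summable_integral_norm hFint hsum]
  refine integral_congr_ae (ae_of_all _ fun y => ?_)
  rw [hF]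
  dsimp only
  rw [tsum_mul_left, rhoLim]

end LocalSecondLawOneBodyStatics
end Summit.AtomisticToContinuum.HydrodynamicLimit.Theorems
end
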